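import Summits.QuantumFields.YangMills.Theorems.AllWindowsColdBoxKernelConvolutionSkin
import Summits.QuantumFields.YangMills.Theorems.AllWindowsColdBoxJaffardDecay

/-!
# The Schur–Jaffard block decay theorem (abstract (J′4) of STUB-PLAN-U1 rev 3 §7; LINE-19/20 S3b `LandauKernelDecay`, LINE-18 K1)

A symmetric block matrix `Q = [[A, C], [Cᵀ, K]]` on `S ⊕ R` ("skin ⊕ rest") with
* (h1) `|K⁻¹ r r'| ≤ c₁ (1+d)^{−2}` (size decay of the rest Green function),
* (h2) `|(K⁻¹Cᵀ) r s| ≤ c₂ (1+d)^{−3}` (the coupling to the skin is a gradient),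
* (h3) the skin Schur complement `M′ = A − C K⁻¹ Cᵀ` coercive (`m₀‖v‖² ≤ vᵀM′v`) with `|M′ s s'| ≤ c₃ (1+d)^{−4}`,
on an index set whose skin has `D_S`-dimensional growth with `D_S < 7/2` (`D_S = 3` for the cold box), satisfies
**`|Q⁻¹ e e'| ≤ C (1 + d e e')^{−2}` for ALL `e, e'`, with `C` depending only on `(D_S, c_S, c₁, c₂, c₃, m₀)`** — NO logarithm.
Proof: the explicit block inverse `Q⁻¹ = [[M′⁻¹, −M′⁻¹CK⁻¹], [−K⁻¹CᵀM′⁻¹, K⁻¹ + K⁻¹CᵀM′⁻¹CK⁻¹]]` (checked by multiplication), Jaffard's theorem for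
`M′⁻¹` (`r = 4 > D_S`, ✓`inverse_decay_of_posDef_of_growth`), and the no-log skin convolutions ✓`conv_three_four_le` (`K⁻¹CᵀM′⁻¹ ~ (1+d)^{−3}`),
✓`conv_three_three_le` (`K⁻¹CᵀM′⁻¹CK⁻¹ ~ (1+d)^{−5/2}`).
* `schur_jaffard_decay` — the theorem (constants quantified BEFORE the index sets).
Mathlib-only; no definitions; standard axioms.

HONEST LABEL: helper theorem toward the OPEN stubs S3b/U1 (⟨stmt-QuantumFields-24004⟩, ⟨24336⟩) and K1 (⟨24006⟩): the assembler instantiates S = skin links,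
R = rest links, K = K^rel = ⊕_μ boxLap (✓`…BoxKernel*`), (h1)–(h3) from the box-kernel decay package; no stub, crux, rung or summit is proved here; the
Yang–Mills mass gap is NOT proved by this file.
-/

set_option autoImplicit false

open Finset Matrix

namespace Summit.QuantumFields.YangMills.Theorems.AllWindowsColdBox.Jaffard

universe u

/-! ## The explicit block inverse -/

section BlockInverse

variable {S R : Type*} [Fintype S] [DecidableEq S] [Fintype R] [DecidableEq R]

/-- **Block inverse by the skin Schur complement**: if `K KI = 1` and `(A − C KI Cᵀ) MI = 1` then
`[[A, C],[Cᵀ, K]] · [[MI, −MI C KI],[−KI Cᵀ MI, KI + KI Cᵀ MI C KI]] = 1`. -/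
theorem fromBlocks_mul_schurInverse (A : Matrix S S ℝ) (C : Matrix S R ℝ) (K KI : Matrix R R ℝ) (MI : Matrix S S ℝ)
    (hK : K * KI = 1) (hM : (A - C * KI * Cᵀ) * MI = 1) :
    Matrix.fromBlocks A C Cᵀ K *
        Matrix.fromBlocks MI (-(MI * C * KI)) (-(KI * Cᵀ * MI)) (KI + KI * Cᵀ * MI * C * KI) = 1 := by
  rw [Matrix.fromBlocks_multiply, ← Matrix.fromBlocks_one]
  have hAM : A * MI = 1 + C * KI * Cᵀ * MI := by
    rw [Matrix.sub_mul] at hM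
    rw [← hM, sub_add_cancel]
  have h11 : A * MI + C * -(KI * Cᵀ * MI) = 1 := by
    have e : C * (KI * Cᵀ * MI) = C * KI * Cᵀ * MI := by simp only [Matrix.mul_assoc]
    rw [Matrix.mul_neg, e, hAM]
    abel
  have h12 : A * -(MI * C * KI) + C * (KI + KI * Cᵀ * MI * C * KI) = 0 := by
    have e1 : A * (MI * C * KI) = (A * MI) * (C * KI) := by simp only [Matrix.mul_assoc]
    have e2 : C * (KI * Cᵀ * MI * C * KI) = (C * KI * Cᵀ * MI) * (C * KI) := by simp only [Matrix.mul_assoc]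
    rw [Matrix.mul_neg, Matrix.mul_add, e1, e2, hAM, Matrix.add_mul, Matrix.one_mul]
    abel
  have h21 : Cᵀ * MI + K * -(KI * Cᵀ * MI) = 0 := by
    have e : K * (KI * Cᵀ * MI) = (K * KI) * (Cᵀ * MI) := by simp only [Matrix.mul_assoc]
    rw [Matrix.mul_neg, e, hK, Matrix.one_mul, add_neg_cancel]
  have h22 : Cᵀ * -(MI * C * KI) + K * (KI + KI * Cᵀ * MI * C * KI) = 1 := by
    have e3 : K * (KI * Cᵀ * MI * C * KI) = (K * KI) * (Cᵀ * (MI * C * KI)) := by simp only [Matrix.mul_assoc]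
    rw [Matrix.mul_neg, Matrix.mul_add, e3, hK, Matrix.one_mul]
    abel
  rw [h11, h12, h21, h22]

end BlockInverse

/-! ## The decay theorem -/

/-- An invertibility lemma: a symmetric coercive matrix has unit determinant. -/
theorem isUnit_det_of_coercive {S : Type*} [Fintype S] [DecidableEq S] {M : Matrix S S ℝ} {m₀ : ℝ} (hm : 0 < m₀)
    (hcoer : ∀ v : S → ℝ, m₀ * ∑ x, v x ^ 2 ≤ v ⬝ᵥ (M *ᵥ v)) : IsUnit M.det := by
  rw [← Matrix.isUnit_iff_isUnit_det, ← Matrix.mulVec_injective_iff_isUnit]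
  intro v w hvw
  have h0 : M *ᵥ (v - w) = 0 := by rw [Matrix.mulVec_sub, hvw, sub_self]
  have h1 := hcoer (v - w)
  rw [h0, dotProduct_zero] at h1
  have hs0 : 0 ≤ ∑ x, (v - w) x ^ 2 := Finset.sum_nonneg fun x _ => sq_nonneg _
  have hs : ∑ x, (v - w) x ^ 2 = 0 := by nlinarith
  funext x
  have := (Finset.sum_eq_zero_iff_of_nonneg fun x _ => sq_nonneg ((v - w) x)).1 hs x (Finset.mem_univ x)
  rw [sq_eq_zero_iff, Pi.sub_apply, sub_eq_zero] at this
  exact this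

/-- **The Schur–Jaffard block decay theorem.**  See the module docstring: `|Q⁻¹ e e'| (1 + d e e')² ≤ C` for the block matrix
`Q = fromBlocks A C Cᵀ K` under (h1) size decay of `KI = K⁻¹`, (h2) gradient decay of `KI Cᵀ`, (h3) coercivity and `(1+d)^{−4}` decay of the skin
Schur complement `A − C KI Cᵀ`, on a skin of growth dimension `D_S < 7/2`; `C` depends only on the displayed constants. -/
theorem schur_jaffard_decay {DS cS c₁ c₂ c₃ m₀ : ℝ} (hDS : 0 < DS) (hDS' : DS < 7 / 2) (hcS : 0 < cS)
    (hc₁ : 0 ≤ c₁) (hc₂ : 0 ≤ c₂) (hc₃ : 0 ≤ c₃) (hm : 0 < m₀) :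
    ∃ Cfin : ℝ, 0 ≤ Cfin ∧ ∀ {S R : Type u} [Fintype S] [DecidableEq S] [Fintype R] [DecidableEq R]
      (d : S ⊕ R → S ⊕ R → ℝ),
      (∀ x y, 0 ≤ d x y) → (∀ x, d x x = 0) → (∀ x y, d x y = d y x) → (∀ x y z, d x y ≤ d x z + d z y) →
      (∀ (y : S ⊕ R) (ρ : ℝ), 0 ≤ ρ → ((Finset.univ.filter (fun s : S => d (Sum.inl s) y ≤ ρ)).card : ℝ) ≤ cS * (1 + ρ) ^ DS) →
      ∀ (A : Matrix S S ℝ) (C : Matrix S R ℝ) (K KI : Matrix R R ℝ), A.IsSymm → KI.IsSymm → K * KI = 1 →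
        (∀ r r', |KI r r'| * (1 + d (Sum.inr r) (Sum.inr r')) ^ (2 : ℝ) ≤ c₁) →
        (∀ r s, |(KI * Cᵀ) r s| * (1 + d (Sum.inr r) (Sum.inl s)) ^ (3 : ℝ) ≤ c₂) →
        (∀ v : S → ℝ, m₀ * ∑ x, v x ^ 2 ≤ v ⬝ᵥ ((A - C * KI * Cᵀ) *ᵥ v)) →
        (∀ s s', |(A - C * KI * Cᵀ) s s'| * (1 + d (Sum.inl s) (Sum.inl s')) ^ (4 : ℝ) ≤ c₃) →
        ∀ e e', |(Matrix.fromBlocks A C Cᵀ K)⁻¹ e e'| * (1 + d e e') ^ (2 : ℝ) ≤ Cfin := by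
  -- parameter-only constants
  have h4 : DS < 4 := by linarith
  obtain ⟨CJ, hCJ0, hJ⟩ := inverse_decay_of_posDef_of_growth (r := 4) (D := DS) (cS := cS) (m₀ := m₀) (C := c₃) hDS h4 hcS hm hc₃
  set T₄ : ℝ := cS * (2 : ℝ) ^ DS * (1 - (2 : ℝ) ^ (DS - 4))⁻¹ with hT₄
  set T : ℝ := cS * (2 : ℝ) ^ DS * (1 - (2 : ℝ) ^ (DS - 7 / 2))⁻¹ with hT
  have h2lt : ∀ t : ℝ, t < 0 → (2 : ℝ) ^ t < 1 := fun t ht => Real.rpow_lt_one_of_one_lt_of_neg one_lt_two ht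
  have hT₄0 : 0 ≤ T₄ := by
    have := h2lt (DS - 4) (by linarith)
    have : 0 ≤ (1 - (2 : ℝ) ^ (DS - 4))⁻¹ := inv_nonneg.2 (by linarith)
    positivity
  have hT0 : 0 ≤ T := by
    have := h2lt (DS - 7 / 2) (by linarith)
    have : 0 ≤ (1 - (2 : ℝ) ^ (DS - 7 / 2))⁻¹ := inv_nonneg.2 (by linarith)
    positivity
  set L₁ : ℝ := c₂ * CJ * (8 * T₄ + 32 * T) with hL₁
  have hL₁0 : 0 ≤ L₁ := by positivity
  set L₂ : ℝ := c₁ + L₁ * c₂ * (24 * T) with hL₂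
  have hL₂0 : 0 ≤ L₂ := by positivity
  refine ⟨CJ + L₁ + L₂, by positivity, ?_⟩
  intro S R _ _ _ _ d hd0 hdd hdsymm htri hG A C K KI hA hKI hK h1 h2 hcoer h3
  -- the skin Schur complement and its inverse
  set M' : Matrix S S ℝ := A - C * KI * Cᵀ with hM'
  have hM'symm : M'.IsSymm := by
    rw [Matrix.IsSymm, hM', Matrix.transpose_sub, Matrix.transpose_mul, Matrix.transpose_mul, Matrix.transpose_transpose, hA.eq,
      hKI.eq, Matrix.mul_assoc]
  have hdet : IsUnit M'.det := isUnit_det_of_coercive hm hcoer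
  set MI : Matrix S S ℝ := M'⁻¹ with hMI
  have hMMI : M' * MI = 1 := Matrix.mul_nonsing_inv _ hdet
  have hMIsymm : MI.IsSymm := by
    rw [Matrix.IsSymm, hMI, Matrix.transpose_nonsing_inv, hM'symm.eq]
  -- Jaffard on the skin
  set dS : S → S → ℝ := fun s s' => d (Sum.inl s) (Sum.inl s') with hdS
  obtain ⟨hMIdec, hMIcol⟩ := hJ dS (fun x y => hd0 _ _) (fun x => hdd _) (fun x y => hdsymm _ _) (fun x y z => htri _ _ _)
    (fun y ρ hρ => hG (Sum.inl y) ρ hρ) M' hM'symm hcoer h3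
  -- row sums over the skin around any point
  have hrow : ∀ (y : S ⊕ R) (t : ℝ), DS < t → ∑ s : S, ((1 + d (Sum.inl s) y) ^ t)⁻¹ ≤ cS * (2 : ℝ) ^ DS * (1 - (2 : ℝ) ^ (DS - t))⁻¹ :=
    fun y t ht => sum_inv_rpow_le_of_growth_ext (fun s : S => d (Sum.inl s) y) hDS.le ht hcS.le (fun s => hd0 _ _) (fun ρ hρ => hG y ρ hρ)
  have hrow' : ∀ (y : S ⊕ R) (t : ℝ), DS < t → ∑ s : S, ((1 + d y (Sum.inl s)) ^ t)⁻¹ ≤ cS * (2 : ℝ) ^ DS * (1 - (2 : ℝ) ^ (DS - t))⁻¹ := by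
    intro y t ht
    have h := hrow y t ht
    rwa [show (fun s : S => ((1 + d (Sum.inl s) y) ^ t)⁻¹) = fun s => ((1 + d y (Sum.inl s)) ^ t)⁻¹ from
      funext fun s => by rw [hdsymm]] at h
  -- the block inverse
  set G : Matrix (S ⊕ R) (S ⊕ R) ℝ :=
    Matrix.fromBlocks MI (-(MI * C * KI)) (-(KI * Cᵀ * MI)) (KI + KI * Cᵀ * MI * C * KI) with hGdef
  have hQG : Matrix.fromBlocks A C Cᵀ K * G = 1 := fromBlocks_mul_schurInverse A C K KI MI hK hMMI
  have hinv : (Matrix.fromBlocks A C Cᵀ K)⁻¹ = G := Matrix.inv_eq_right_inv hQG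
  rw [hinv]
  -- the mixed kernel `E = KI Cᵀ MI` decays like `(1+d)^{-3}`
  have hE : ∀ (r : R) (s : S), |(KI * Cᵀ * MI) r s| * (1 + d (Sum.inr r) (Sum.inl s)) ^ (3 : ℝ) ≤ L₁ := by
    intro r s
    rw [Matrix.mul_apply]
    have hconv := conv_three_four_le (S := S) (fun s' => d (Sum.inr r) (Sum.inl s')) (fun s' => d (Sum.inl s') (Sum.inl s))
      (d (Sum.inr r) (Sum.inl s)) (fun s' => hd0 _ _) (fun s' => hd0 _ _) (hd0 _ _) (fun s' => htri _ _ _)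
      (T₄ := T₄) (T := T) (hrow (Sum.inl s) 4 h4) (hrow' (Sum.inr r) (7 / 2) hDS') (hrow (Sum.inl s) (7 / 2) hDS')
    have hterm : ∀ s', |(KI * Cᵀ) r s' * MI s' s| ≤
        c₂ * CJ * (((1 + d (Sum.inr r) (Sum.inl s')) ^ (3 : ℝ))⁻¹ * ((1 + d (Sum.inl s') (Sum.inl s)) ^ (4 : ℝ))⁻¹) := by
      intro s'
      have hw3 : 0 < (1 + d (Sum.inr r) (Sum.inl s')) ^ (3 : ℝ) := Real.rpow_pos_of_pos (by linarith [hd0 (Sum.inr r) (Sum.inl s')]) _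
      have hw4 : 0 < (1 + d (Sum.inl s') (Sum.inl s)) ^ (4 : ℝ) := Real.rpow_pos_of_pos (by linarith [hd0 (Sum.inl s') (Sum.inl s)]) _
      have ha : |(KI * Cᵀ) r s'| ≤ c₂ * ((1 + d (Sum.inr r) (Sum.inl s')) ^ (3 : ℝ))⁻¹ := by
        rw [← div_eq_mul_inv, le_div_iff₀ hw3]; exact h2 r s'
      have hb : |MI s' s| ≤ CJ * ((1 + d (Sum.inl s') (Sum.inl s)) ^ (4 : ℝ))⁻¹ := by
        rw [← div_eq_mul_inv, le_div_iff₀ hw4]; exact hMIdec s' s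
      rw [abs_mul]
      calc |(KI * Cᵀ) r s'| * |MI s' s| ≤ (c₂ * ((1 + d (Sum.inr r) (Sum.inl s')) ^ (3 : ℝ))⁻¹) * (CJ * ((1 + d (Sum.inl s') (Sum.inl s)) ^ (4 : ℝ))⁻¹) :=
            mul_le_mul ha hb (abs_nonneg _) (by positivity)
        _ = _ := by ring
    have hw : 0 < (1 + d (Sum.inr r) (Sum.inl s)) ^ (3 : ℝ) := Real.rpow_pos_of_pos (by linarith [hd0 (Sum.inr r) (Sum.inl s)]) _
    calc |∑ s', (KI * Cᵀ) r s' * MI s' s| * (1 + d (Sum.inr r) (Sum.inl s)) ^ (3 : ℝ)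
          ≤ (∑ s', |(KI * Cᵀ) r s' * MI s' s|) * (1 + d (Sum.inr r) (Sum.inl s)) ^ (3 : ℝ) :=
          mul_le_mul_of_nonneg_right (Finset.abs_sum_le_sum_abs _ _) hw.le
      _ ≤ (c₂ * CJ * ∑ s', ((1 + d (Sum.inr r) (Sum.inl s')) ^ (3 : ℝ))⁻¹ * ((1 + d (Sum.inl s') (Sum.inl s)) ^ (4 : ℝ))⁻¹) *
            (1 + d (Sum.inr r) (Sum.inl s)) ^ (3 : ℝ) := by
          refine mul_le_mul_of_nonneg_right ?_ hw.le
          rw [Finset.mul_sum]; exact Finset.sum_le_sum fun s' _ => hterm s'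
      _ ≤ (c₂ * CJ * ((8 * T₄ + 32 * T) * ((1 + d (Sum.inr r) (Sum.inl s)) ^ (3 : ℝ))⁻¹)) * (1 + d (Sum.inr r) (Sum.inl s)) ^ (3 : ℝ) :=
          mul_le_mul_of_nonneg_right (mul_le_mul_of_nonneg_left hconv (by positivity)) hw.le
      _ = L₁ := by rw [hL₁]; field_simp
  -- the weight comparison `(1+d)^2 ≤ (1+d)^t` for `t ≥ 2`
  have hwle : ∀ (x y : S ⊕ R) (t : ℝ), 2 ≤ t → (1 + d x y) ^ (2 : ℝ) ≤ (1 + d x y) ^ t := fun x y t ht =>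
    Real.rpow_le_rpow_of_exponent_le (by linarith [hd0 x y]) ht
  have hw0 : ∀ (x y : S ⊕ R) (t : ℝ), 0 ≤ (1 + d x y) ^ t := fun x y t => Real.rpow_nonneg (by linarith [hd0 x y]) t
  -- the four blocks
  intro e e'
  rcases e with s | r <;> rcases e' with s' | r'
  · -- SS: `MI`
    rw [hGdef, Matrix.fromBlocks_apply₁₁]
    calc |MI s s'| * (1 + d (Sum.inl s) (Sum.inl s')) ^ (2 : ℝ) ≤ |MI s s'| * (1 + d (Sum.inl s) (Sum.inl s')) ^ (4 : ℝ) :=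
          mul_le_mul_of_nonneg_left (hwle _ _ 4 (by norm_num)) (abs_nonneg _)
      _ ≤ CJ := hMIdec s s'
      _ ≤ CJ + L₁ + L₂ := by linarith
  · -- SR: `-(MI C KI) s r' = -(KI Cᵀ MI) r' s`
    rw [hGdef, Matrix.fromBlocks_apply₁₂, Matrix.neg_apply, abs_neg]
    have htr : (MI * C * KI) s r' = (KI * Cᵀ * MI) r' s := by
      have : (MI * C * KI)ᵀ = KI * Cᵀ * MI := by
        rw [Matrix.transpose_mul, Matrix.transpose_mul, hKI.eq, hMIsymm.eq, Matrix.mul_assoc]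
      rw [← this, Matrix.transpose_apply]
    rw [htr, hdsymm]
    calc |(KI * Cᵀ * MI) r' s| * (1 + d (Sum.inr r') (Sum.inl s)) ^ (2 : ℝ)
          ≤ |(KI * Cᵀ * MI) r' s| * (1 + d (Sum.inr r') (Sum.inl s)) ^ (3 : ℝ) :=
          mul_le_mul_of_nonneg_left (hwle _ _ 3 (by norm_num)) (abs_nonneg _)
      _ ≤ L₁ := hE r' s
      _ ≤ CJ + L₁ + L₂ := by linarith
  · -- RS
    rw [hGdef, Matrix.fromBlocks_apply₂₁, Matrix.neg_apply, abs_neg]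
    calc |(KI * Cᵀ * MI) r s'| * (1 + d (Sum.inr r) (Sum.inl s')) ^ (2 : ℝ)
          ≤ |(KI * Cᵀ * MI) r s'| * (1 + d (Sum.inr r) (Sum.inl s')) ^ (3 : ℝ) :=
          mul_le_mul_of_nonneg_left (hwle _ _ 3 (by norm_num)) (abs_nonneg _)
      _ ≤ L₁ := hE r s'
      _ ≤ CJ + L₁ + L₂ := by linarith
  · -- RR: `KI + (KI Cᵀ MI) (C KI)`
    rw [hGdef, Matrix.fromBlocks_apply₂₂, Matrix.add_apply]
    have hsecond : |(KI * Cᵀ * MI * C * KI) r r'| * (1 + d (Sum.inr r) (Sum.inr r')) ^ (2 : ℝ) ≤ L₁ * c₂ * (24 * T) := by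
      have hprod : KI * Cᵀ * MI * C * KI = (KI * Cᵀ * MI) * (KI * Cᵀ)ᵀ := by
        rw [Matrix.transpose_mul, Matrix.transpose_transpose, hKI.eq, Matrix.mul_assoc]
      rw [hprod, Matrix.mul_apply]
      have hconv := conv_three_three_le (S := S) (fun s => d (Sum.inr r) (Sum.inl s)) (fun s => d (Sum.inl s) (Sum.inr r'))
        (d (Sum.inr r) (Sum.inr r')) (fun s => hd0 _ _) (fun s => hd0 _ _) (hd0 _ _) (fun s => htri _ _ _)
        (T := T) (hrow' (Sum.inr r) (7 / 2) hDS') (hrow (Sum.inr r') (7 / 2) hDS')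
      have hterm : ∀ s, |(KI * Cᵀ * MI) r s * (KI * Cᵀ)ᵀ s r'| ≤
          L₁ * c₂ * (((1 + d (Sum.inr r) (Sum.inl s)) ^ (3 : ℝ))⁻¹ * ((1 + d (Sum.inl s) (Sum.inr r')) ^ (3 : ℝ))⁻¹) := by
        intro s
        have hw3 : 0 < (1 + d (Sum.inr r) (Sum.inl s)) ^ (3 : ℝ) := Real.rpow_pos_of_pos (by linarith [hd0 (Sum.inr r) (Sum.inl s)]) _
        have hw3' : 0 < (1 + d (Sum.inl s) (Sum.inr r')) ^ (3 : ℝ) := Real.rpow_pos_of_pos (by linarith [hd0 (Sum.inl s) (Sum.inr r')]) _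
        have ha : |(KI * Cᵀ * MI) r s| ≤ L₁ * ((1 + d (Sum.inr r) (Sum.inl s)) ^ (3 : ℝ))⁻¹ := by
          rw [← div_eq_mul_inv, le_div_iff₀ hw3]; exact hE r s
        have hb : |(KI * Cᵀ)ᵀ s r'| ≤ c₂ * ((1 + d (Sum.inl s) (Sum.inr r')) ^ (3 : ℝ))⁻¹ := by
          rw [Matrix.transpose_apply, ← div_eq_mul_inv, le_div_iff₀ hw3', hdsymm]; exact h2 r' s
        rw [abs_mul]
        calc |(KI * Cᵀ * MI) r s| * |(KI * Cᵀ)ᵀ s r'|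
              ≤ (L₁ * ((1 + d (Sum.inr r) (Sum.inl s)) ^ (3 : ℝ))⁻¹) * (c₂ * ((1 + d (Sum.inl s) (Sum.inr r')) ^ (3 : ℝ))⁻¹) :=
              mul_le_mul ha hb (abs_nonneg _) (by positivity)
          _ = _ := by ring
      have hw : 0 < (1 + d (Sum.inr r) (Sum.inr r')) ^ (2 : ℝ) := Real.rpow_pos_of_pos (by linarith [hd0 (Sum.inr r) (Sum.inr r')]) _
      have hw52 : ((1 + d (Sum.inr r) (Sum.inr r')) ^ (5 / 2 : ℝ))⁻¹ * (1 + d (Sum.inr r) (Sum.inr r')) ^ (2 : ℝ) ≤ 1 := by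
        rw [inv_mul_le_iff₀ (Real.rpow_pos_of_pos (by linarith [hd0 (Sum.inr r) (Sum.inr r')]) _), mul_one]
        exact hwle _ _ (5 / 2) (by norm_num)
      calc |∑ s, (KI * Cᵀ * MI) r s * (KI * Cᵀ)ᵀ s r'| * (1 + d (Sum.inr r) (Sum.inr r')) ^ (2 : ℝ)
            ≤ (∑ s, |(KI * Cᵀ * MI) r s * (KI * Cᵀ)ᵀ s r'|) * (1 + d (Sum.inr r) (Sum.inr r')) ^ (2 : ℝ) :=
            mul_le_mul_of_nonneg_right (Finset.abs_sum_le_sum_abs _ _) hw.le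
        _ ≤ (L₁ * c₂ * ∑ s, ((1 + d (Sum.inr r) (Sum.inl s)) ^ (3 : ℝ))⁻¹ * ((1 + d (Sum.inl s) (Sum.inr r')) ^ (3 : ℝ))⁻¹) *
              (1 + d (Sum.inr r) (Sum.inr r')) ^ (2 : ℝ) := by
            refine mul_le_mul_of_nonneg_right ?_ hw.le
            rw [Finset.mul_sum]; exact Finset.sum_le_sum fun s _ => hterm s
        _ ≤ (L₁ * c₂ * (24 * T * ((1 + d (Sum.inr r) (Sum.inr r')) ^ (5 / 2 : ℝ))⁻¹)) * (1 + d (Sum.inr r) (Sum.inr r')) ^ (2 : ℝ) :=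
            mul_le_mul_of_nonneg_right (mul_le_mul_of_nonneg_left hconv (by positivity)) hw.le
        _ = L₁ * c₂ * (24 * T) * (((1 + d (Sum.inr r) (Sum.inr r')) ^ (5 / 2 : ℝ))⁻¹ * (1 + d (Sum.inr r) (Sum.inr r')) ^ (2 : ℝ)) := by ring
        _ ≤ L₁ * c₂ * (24 * T) * 1 := mul_le_mul_of_nonneg_left hw52 (by positivity)
        _ = L₁ * c₂ * (24 * T) := mul_one _
    calc |KI r r' + (KI * Cᵀ * MI * C * KI) r r'| * (1 + d (Sum.inr r) (Sum.inr r')) ^ (2 : ℝ)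
          ≤ (|KI r r'| + |(KI * Cᵀ * MI * C * KI) r r'|) * (1 + d (Sum.inr r) (Sum.inr r')) ^ (2 : ℝ) :=
          mul_le_mul_of_nonneg_right (abs_add_le _ _) (hw0 _ _ _)
      _ ≤ c₁ + L₁ * c₂ * (24 * T) := by rw [add_mul]; exact add_le_add (h1 r r') hsecond
      _ = L₂ := by rw [hL₂]
      _ ≤ CJ + L₁ + L₂ := by linarith

end Summit.QuantumFields.YangMills.Theorems.AllWindowsColdBox.Jaffard
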